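import Literature.Geometry.Kaehler.RiemannSurfaceChevalleyWeilLocal
import HarnessLib

/-!
# The Chevalley–Weil formula: the character of `G ≤ Aut M` on `𝓗¹(M)` —
# `Σ_{h ∈ G} tr(h⁻¹|𝓗¹)·χ_V(h) = |G|·(dim V^G + dim V·(γ − 1)) + Σ_{P : G_P ≠ 1} Σ_α α·N_{P,α}`
# (Chevalley–Weil 1934; Kopeliovich–Zemel Theorem 6.6, Proposition 7.1; Frediani–Ghigi–Penegini Theorem 2.10)

Layer `Literature/Geometry/Kaehler`, sequel of `RiemannSurfaceChevalleyWeilLocal` (the contribution of a fixed point: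
`Σ_{h ∈ G_P ∖ 1} a_P(h)χ_V(h)/(1 − a_P(h)) = Σ_α α·N_{P,α} − dim V·(m − 1)/2`) and of
`RiemannSurfaceEichlerTraceFormula` (`tr T = 1 + Σ_{P ∈ Fix T} a_P(T⁻¹)/(1 − a_P(T⁻¹))`, `Aut M` finite),
`RiemannSurfaceHurwitzAutomorphismBound` (Riemann–Hurwitz `2g̃ − 2 = |G|(2γ − 2) + deg R_π`, `R_π(P) = |G_P| − 1`) and
`RiemannSurfaceRationalCharacterFormula` (`Σ_h χ_V(h) = |G| dim V^G`). For a finite group `G ≤ Aut M` of the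
compact connected Riemann surface `M` of genus `g̃` (with `Aut M` finite, e.g. `g̃ ≥ 2`), `π : M → M/G` of genus
`γ`, the CHEVALLEY–WEIL FORMULA computes the multiplicity of every irreducible complex representation in the
`G`-module `𝓗¹(M) = H⁰(M, Ω¹)` (`Tφ = (T⁻¹)^*φ`, `oneFormRep`) from the local rotation data at the ramification points.
S. Kopeliovich, S. Zemel, Israel J. Math. 234 (2019), as printed (arXiv copy pp. 26–30; our case is `q = 1`, `Γ = 0`,
where `δ = 1` and `χ_δ = 1`):

> **Proposition 6.5.** […] the trace of the action of `τ` on `Ω^q(1/f^*(Γ))` is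
> `δ·χ_δ(τ) + Σ_{P ∈ X | τ(P) = P} χ_P(τ)^q/(1 − χ_P(τ))`, where […] `χ_P` is the character in `Ĥ` that takes the
> element `ψ(P)`, which generates `H`, to `ζ_d`.
> **Theorem 6.6.** Let `f : X → S` be a Galois cover, with Galois group `G`, and take an index `q` and an integral
> divisor `Γ` on `S`. […] Then a representation `ρ ∈ Irr_ℂ(G)` appears in the representation of `G` on the space
> `Ω^q(1/f^*(Γ))` with multiplicity
> `d_ρ[(2q − 1)(g_S − 1) + deg Γ] + Σ_C r_C Σ_{α=0}^{o(C)−1} N^ρ_{C,α}[(q − 1)(1 − 1/o(C)) + {(q − 1 − α)/o(C)}]`,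
> plus `1` if the parameter `δ` […] equals `1` and `ρ` is the 1-dimensional representation denoted by `χ_δ` there.
> *Proof.* We recall from representation theory that the multiplicity of `ρ` inside any representation of `G` on
> some vector space `V` is `(1/n) Σ_{τ ∈ G} χ_V(τ)χ_ρ(τ⁻¹)`. […] we consider, for each point `P ∈ X`, its stabilizer
> in `G`. […] We therefore get contributions here only from branch points […] we get the same contribution from all
> the `n/o(C)` points lying over each of the `r_C` elements `η ∈ S` for which `ψ(η) = C` […]
> **Proposition 7.1.** The multiplicity in which an element `ρ ∈ Irr_ℂ(G)` appears in `ρ_a` is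
> `d_ρ(g_S − 1) + δ_{ρ,1} + Σ_C r_C Σ_{α=0}^{o(C)−1} N^ρ_{C,α}{α/o(C)}`. In particular […] the multiplicity of `1` in
> that representation is `g_S`.

P. Frediani, A. Ghigi, M. Penegini, IMRN 2015, as printed (arXiv copy p. 14, `γ = 0`):

> **Theorem 2.10** (Chevalley–Weil [6]). Let `C → ℙ¹` be a `G`-Galois cover branched at `r` points. Let `m_i` and
> `E_{i,α}` be as above. Then the multiplicity `μ_χ` of a given irreducible character `χ` in `H⁰(C, K_C)` is
> `μ_χ = −d_χ + Σ_{i=1}^{r} Σ_{α=0}^{m_i−1} E_{i,α}⟨−α/m_i⟩ + ε`, where `ε = 1` if `χ` is the trivial character and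
> `ε = 0` otherwise.

THE FORM PROVED HERE. With the tree's normalisation (`a_P = stabDeriv P`, the rotation character of the cyclic
stabilizer `G_P` of order `m_P`; Eichler as in Farkas–Kra V.2.9) the formula is stated as a character sum over the
group and a sum over the ramification POINTS `P` of `π` (the support of `R_π`):

  `Σ_{h ∈ G} tr(h⁻¹|𝓗¹(M))·χ_V(h) = |G|·(dim V^G + dim V·(γ − 1)) + Σ_{P : G_P ≠ 1} Σ_{α=0}^{m_P−1} α·N_{P,α}`,

for EVERY finite-dimensional complex representation `(V, ρ)` of `G`, where `N_{P,α}` is the multiplicity of the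
character `a_P^α` in `V|_{G_P}` (`= dim Eig(ρ(g), a_P(g)^α)` for any generator `g` of `G_P`,
`eigenspace_eq_iInf_eigenspace_stabDeriv_pow`). The left side is `|G|·⟨χ_{𝓗¹}, χ_V⟩`
(`sum_trace_mul_trace_inv_eq`), so for irreducible `V` the multiplicity of `V` in `𝓗¹(M)` is
`d_V(γ − 1) + δ_{V,1} + |G|⁻¹ Σ_P Σ_α α·N_{P,α}`; since the `|G|/m_t` points over a branch value `q_t` contribute
equally, this is the printed `d_ρ(g_S − 1) + δ_{ρ,1} + Σ_t Σ_α N_{t,α}·(α/m_t)` (Proposition 7.1's shape; in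
Theorem 6.6 and in Theorem 2.10 the eigenvalues are indexed through the inverse generator, `{−α/m}`) — the grouping
over branch values (`a_{gP}(ghg⁻¹) = a_P(h)`) is not carried out in this file.

## What is formalized (everything proved; no definitions, no named facts, no instances)

* §1 `trace_oneFormRep_inv_eq_one_add_sum` (Eichler at `h⁻¹`: `tr(h⁻¹) = 1 + Σ_{P ∈ Fix h} a_P(h)/(1 − a_P(h))`),
  `mem_support_ramificationDiv_of_smul_eq`, `degree_ramificationDiv_mk_eq_sum_card_stabilizer_sub_one`
  (`deg R_π = Σ_P (|G_P| − 1)`), `toFinset_fixedBy_eq_filter`, `sum_erase_one_sum_filter_eq_sum_support_sum`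
  (`Σ_{h≠1} Σ_{P ∈ Fix h} = Σ_{P : G_P ≠ 1} Σ_{h ∈ G_P ∖ 1}`);
* §2 **THE CHEVALLEY–WEIL FORMULA**: `chevalleyWeil_sum_trace_inv_mul_trace_eq` (with chosen generators),
  `exists_stabilizer_generators`, **`chevalleyWeil_sum_trace_inv_mul_trace_eq_iInf`** (intrinsic `N_{P,α}`),
  `sum_trace_mul_trace_inv_eq`, **`chevalleyWeil_multiplicity_of_invariants_eq_bot`** (`V^G = 0`),
  **`sum_trace_oneFormRep_eq_arithGenus_mul_card`** (`Σ_h tr(h|𝓗¹) = γ·|G|`: the trivial representation has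
  multiplicity `γ`);
* §3 the same under the printed hypothesis `g̃ ≥ 2` (`…_of_two_le_arithGenus`).

## References

* C. Chevalley, A. Weil, *Über das Verhalten der Integrale 1. Gattung bei Automorphismen des Funktionenkörpers*,
  Abh. Math. Sem. Hamburg 10 (1934), 358–361. [ChevalleyWeil1934Integrale]
* S. Kopeliovich, S. Zemel, *On spaces associated with invariant divisors on Galois covers of Riemann surfaces and
  their applications*, Israel J. Math. 234 (2019), 393–450: Proposition 6.5, Theorem 6.6 (with proof), Proposition 7.1
  (arXiv:1609.02296, pp. 26–30). [KopeliovichZemel2019]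
* P. Frediani, A. Ghigi, M. Penegini, *Shimura varieties in the Torelli locus via Galois coverings*, IMRN 2015,
  Theorem 2.7 (Eichler), Theorem 2.10 (Chevalley–Weil) (arXiv:1402.0973, pp. 13–14). [FredianiGhigiPenegini2015]
* H. M. Farkas, I. Kra, *Riemann Surfaces*, GTM 71, 2nd ed. (1992), V.1.3, V.2.2, V.2.9. [FarkasKra1992]
* R. Miranda, *Algebraic Curves and Riemann Surfaces*, GSM 5 (1995), Chapter III Proposition 3.1, Corollary 3.7.
  [Miranda1995]
-/

noncomputable section

open scoped Manifold ContDiff Topology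
open Set Filter Function Complex MulAction Module

namespace Literature.Geometry.Kaehler

namespace RiemannSurface

section ChevalleyWeil

variable {M : Type*} [TopologicalSpace M] [ChartedSpace ℂ M] [IsManifold 𝓘(ℂ, ℂ) ω M]
  [CompactSpace M] [T2Space M] [PreconnectedSpace M] [Nonempty M] [Finite (autGroup M)]
  (G : Subgroup (autGroup M)) {V : Type*} [AddCommGroup V] [Module ℂ V] [FiniteDimensional ℂ V]
  (ρ : Representation ℂ ↥G V)

open OrbitSurface

/-! ### §1 The Eichler trace formula at `h⁻¹`, and the fixed points inside the ramification locus -/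

/-- **Eichler at `h⁻¹`: `tr(h⁻¹|𝓗¹) = 1 + Σ_{P ∈ Fix h} a_P(h)/(1 − a_P(h))`** for `h ≠ 1` in `G ≤ Aut M`
(`(h⁻¹)⁻¹ = h`, `Fix h⁻¹ = Fix h`). [cite: FarkasKra1992, V.2.9 Theorem] [cite: KopeliovichZemel2019, Proposition 6.5] -/
theorem trace_oneFormRep_inv_eq_one_add_sum {h : ↥G} (hh : h ≠ 1) :
    LinearMap.trace ℂ ↥(holomorphicOneForms M) (oneFormRep M ((h⁻¹ : ↥G) : autGroup M)) =
      1 + ∑ P ∈ (finite_fixedBy (M := M) hh).toFinset, stabDeriv P h / (1 - stabDeriv P h) := by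
  have hh' : ((h⁻¹ : ↥G) : autGroup M) ≠ 1 := fun h1 ↦ hh (inv_eq_one.1 (OneMemClass.coe_eq_one.1 h1))
  rw [trace_oneFormRep_eq_one_add_sum hh']
  have hinv : (((h⁻¹ : ↥G) : autGroup M))⁻¹ = (h : autGroup M) := by rw [Subgroup.coe_inv, inv_inv]
  congr 1
  refine Finset.sum_congr ?_ fun P _ ↦ by rw [hinv]; rfl
  ext P
  simp only [Set.Finite.mem_toFinset, mem_fixedBy]
  rw [← Subgroup.smul_def, inv_smul_eq_iff, eq_comm]

/-- **A fixed point of `h ≠ 1` is a ramification point of `π : M → M/G`** (`R_π(P) = |G_P| − 1 ≥ 1`).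
[cite: KopeliovichZemel2019, Theorem 6.6 (proof: «we therefore get contributions here only from branch points»)]
[cite: FarkasKra1992, V.1.3] -/
theorem mem_support_ramificationDiv_of_smul_eq {h : ↥G} (hh : h ≠ 1) {P : M} (hP : h • P = P) :
    P ∈ (ramificationDiv (mk G : M → OrbitSurface G M)).support := by
  rw [Finsupp.mem_support_iff, OrbitSurface.ramificationDiv_mk_apply]
  have h1 : (1 : ↥G) ∈ stabilizer G P := Subgroup.one_mem _
  have h2 : h ∈ stabilizer G P := mem_stabilizer_iff.2 hP
  haveI : Fintype ↥G := Fintype.ofFinite _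
  classical
  have hlt : 1 < Nat.card (stabilizer G P) := by
    rw [Nat.card_eq_fintype_card]
    exact Fintype.one_lt_card_iff_nontrivial.2 ⟨⟨⟨1, h1⟩, ⟨h, h2⟩, fun he ↦ hh (Subtype.ext_iff.1 he).symm⟩⟩
  omega

/-- `R_π(P) = |G_P| − 1` summed over the ramification points: **`deg R_π = Σ_{P : G_P ≠ 1} (|G_P| − 1)`**.
[cite: FarkasKra1992, V.1.3 («the total branch number»)] [cite: Miranda1995, Chapter III Corollary 3.7] -/
theorem degree_ramificationDiv_mk_eq_sum_card_stabilizer_sub_one :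
    ((Finsupp.degree (ramificationDiv (mk G : M → OrbitSurface G M)) : ℤ) : ℂ) =
      ∑ P ∈ (ramificationDiv (mk G : M → OrbitSurface G M)).support, ((Nat.card (stabilizer G P) : ℂ) - 1) := by
  rw [Finsupp.degree_apply, Int.cast_sum]
  refine Finset.sum_congr rfl fun P _ ↦ ?_
  rw [OrbitSurface.ramificationDiv_mk_apply]
  push_cast
  ring

open Classical in
/-- For `h ≠ 1` the fixed point set of `h`, as a finite set, is the part of the ramification locus fixed by `h`.
[cite: KopeliovichZemel2019, Theorem 6.6 (proof)] -/
theorem toFinset_fixedBy_eq_filter {h : ↥G} (hh : h ≠ 1) :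
    (finite_fixedBy (M := M) hh).toFinset =
      (ramificationDiv (mk G : M → OrbitSurface G M)).support.filter fun P ↦ h • P = P := by
  ext P
  simp only [Set.Finite.mem_toFinset, mem_fixedBy, Finset.mem_filter]
  exact ⟨fun hP ↦ ⟨mem_support_ramificationDiv_of_smul_eq G hh hP, hP⟩, fun hP ↦ hP.2⟩

omit [CompactSpace M] [Nonempty M] in
open Classical in
/-- **Reorganising the fixed-point terms over the ramification points**:
`Σ_{h ≠ 1} Σ_{P ∈ Fix h} F(P, h) = Σ_{P : G_P ≠ 1} Σ_{h ∈ G_P, h ≠ 1} F(P, h)` («we consider, for each point `P ∈ X`,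
its stabilizer in `G`»). [cite: KopeliovichZemel2019, Theorem 6.6 (proof)] -/
theorem sum_erase_one_sum_filter_eq_sum_support_sum [Fintype ↥G] [DecidableEq ↥G] (F : M → ↥G → ℂ) :
    ∑ h ∈ (Finset.univ : Finset ↥G).erase 1,
        ∑ P ∈ (ramificationDiv (mk G : M → OrbitSurface G M)).support.filter (fun P ↦ h • P = P), F P h =
      ∑ P ∈ (ramificationDiv (mk G : M → OrbitSurface G M)).support,
        ∑ h ∈ (Finset.univ.filter fun h : ↥G ↦ h • P = P).erase 1, F P h := by
  simp_rw [Finset.sum_filter]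
  rw [Finset.sum_comm]
  refine Finset.sum_congr rfl fun P _ ↦ ?_
  rw [← Finset.filter_erase, Finset.sum_filter]

/-! ### §2 The Chevalley–Weil formula -/

open Classical in
/-- **THE CHEVALLEY–WEIL FORMULA (with chosen generators `g_P` of the stabilizers of the ramification points).**
For `G ≤ Aut M` (`Aut M` finite), `γ` the genus of `M/G`, and every finite-dimensional complex representation
`(V, ρ)` of `G`:
`Σ_{h ∈ G} tr(h⁻¹|𝓗¹(M))·χ_V(h) = |G|·(dim V^G + dim V·(γ − 1)) + Σ_{P : G_P ≠ 1} Σ_{α=0}^{|G_P|−1} α·N_{P,α}`,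
`N_{P,α} = dim Eig(ρ(g_P), a_P(g_P)^α)`; the left side is `|G|` times the multiplicity `⟨χ_{𝓗¹}, χ_V⟩` of `V` in
`𝓗¹(M)` (`tr(h⁻¹) = conj tr(h)`), so for irreducible `V` the multiplicity is
`d_V(γ − 1) + δ_{V,1} + |G|⁻¹ Σ_P Σ_α α N_{P,α}` — grouped over the branch values `q_t` (`|G|/m_t` points each)
this is the printed `d_ρ(g_S − 1) + δ + Σ_t Σ_α N_{t,α}·(α/m_t)`. Proof: Eichler's trace formula at `h⁻¹`, the
fixed-point terms reorganised over the ramification points and evaluated by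
`sum_stabilizer_stabDeriv_div_mul_trace_eq`, `Σ_h χ_V(h) = |G| dim V^G`, and Riemann–Hurwitz
`2g̃ − 2 = |G|(2γ − 2) + Σ_P (|G_P| − 1)`. [cite: KopeliovichZemel2019, Theorem 6.6 (q = 1, Γ = 0), Proposition 7.1]
[cite: ChevalleyWeil1934Integrale] [cite: FredianiGhigiPenegini2015, Theorem 2.10 (γ = 0)] -/
theorem chevalleyWeil_sum_trace_inv_mul_trace_eq [Fintype ↥G] [DecidableEq ↥G] (gen : M → ↥G)
    (hfix : ∀ P ∈ (ramificationDiv (mk G : M → OrbitSurface G M)).support, gen P • P = P)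
    (hgen : ∀ P (hP : P ∈ (ramificationDiv (mk G : M → OrbitSurface G M)).support) (u : stabilizer G P),
      u ∈ Subgroup.zpowers (⟨gen P, mem_stabilizer_iff.2 (hfix P hP)⟩ : stabilizer G P)) :
    ∑ h : ↥G, LinearMap.trace ℂ ↥(holomorphicOneForms M) (oneFormRep M ((h⁻¹ : ↥G) : autGroup M)) *
        LinearMap.trace ℂ V (ρ h) =
      Nat.card ↥G * ((finrank ℂ ↥ρ.invariants : ℂ) +
        (finrank ℂ V : ℂ) * ((arithGenus (OrbitSurface G M) : ℂ) - 1)) +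
      ∑ P ∈ (ramificationDiv (mk G : M → OrbitSurface G M)).support,
        ∑ α ∈ Finset.range (Nat.card (stabilizer G P)),
          (α : ℂ) * finrank ℂ ↥(Module.End.eigenspace (ρ (gen P)) (stabDeriv P (gen P) ^ α)) := by
  set R := (ramificationDiv (mk G : M → OrbitSurface G M)).support with hR
  -- split off `h = 1`
  rw [← Finset.add_sum_erase _ _ (Finset.mem_univ (1 : ↥G)), inv_one, OneMemClass.coe_one, trace_oneFormRep_one,
    trace_map_one_eq_finrank]
  -- Eichler at `h⁻¹` for `h ≠ 1`
  have hE : ∀ h ∈ (Finset.univ : Finset ↥G).erase 1,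
      LinearMap.trace ℂ ↥(holomorphicOneForms M) (oneFormRep M ((h⁻¹ : ↥G) : autGroup M)) * LinearMap.trace ℂ V (ρ h) =
      LinearMap.trace ℂ V (ρ h) +
        ∑ P ∈ R.filter (fun P ↦ h • P = P), stabDeriv P h / (1 - stabDeriv P h) * LinearMap.trace ℂ V (ρ h) := by
    intro h hh
    have hh1 : h ≠ 1 := Finset.ne_of_mem_erase hh
    rw [trace_oneFormRep_inv_eq_one_add_sum G hh1, toFinset_fixedBy_eq_filter G hh1, add_mul, one_mul,
      Finset.sum_mul]
  rw [Finset.sum_congr rfl hE, Finset.sum_add_distrib,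
    sum_erase_one_sum_filter_eq_sum_support_sum G (fun P h ↦ stabDeriv P h / (1 - stabDeriv P h) * LinearMap.trace ℂ V (ρ h))]
  -- `Σ_{h ≠ 1} χ_V(h) = |G| dim V^G − dim V`
  have hA : ∑ h ∈ (Finset.univ : Finset ↥G).erase 1, LinearMap.trace ℂ V (ρ h) =
      Nat.card ↥G * (finrank ℂ ↥ρ.invariants : ℂ) - finrank ℂ V := by
    rw [Nat.card_eq_fintype_card, ← sum_trace_eq_card_mul_finrank_invariants ρ,
      ← Finset.add_sum_erase _ _ (Finset.mem_univ (1 : ↥G)), trace_map_one_eq_finrank]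
    ring
  -- the fixed-point contributions
  have hB : ∀ P ∈ R, ∑ h ∈ (Finset.univ.filter fun h : ↥G ↦ h • P = P).erase 1,
      stabDeriv P h / (1 - stabDeriv P h) * LinearMap.trace ℂ V (ρ h) =
      ∑ α ∈ Finset.range (Nat.card (stabilizer G P)),
          (α : ℂ) * finrank ℂ ↥(Module.End.eigenspace (ρ (gen P)) (stabDeriv P (gen P) ^ α)) -
        (finrank ℂ V : ℂ) * (((Nat.card (stabilizer G P) : ℕ) : ℂ) - 1) / 2 :=
    fun P hP ↦ sum_stabilizer_stabDeriv_div_mul_trace_eq G ρ (hfix P hP) (hgen P hP)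
  rw [Finset.sum_congr rfl hB, Finset.sum_sub_distrib, hA]
  -- Riemann–Hurwitz
  have hdeg : ∑ P ∈ R, (finrank ℂ V : ℂ) * (((Nat.card (stabilizer G P) : ℕ) : ℂ) - 1) / 2 =
      (finrank ℂ V : ℂ) / 2 * ((Finsupp.degree (ramificationDiv (mk G : M → OrbitSurface G M)) : ℤ) : ℂ) := by
    rw [degree_ramificationDiv_mk_eq_sum_card_stabilizer_sub_one, Finset.mul_sum]
    refine Finset.sum_congr rfl fun P _ ↦ ?_
    ring
  have hRH := OrbitSurface.two_mul_arithGenus_sub_two_eq (H := ↥G) (M := M)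
  have hRH' := congrArg (fun z : ℤ ↦ (z : ℂ)) hRH
  push_cast at hRH'
  rw [hdeg]
  linear_combination ((finrank ℂ V : ℂ) / 2) * hRH'

omit [CompactSpace M] [Nonempty M] in
/-- Every stabilizer has a generator (the stabilizers are cyclic, III.7.7). [cite: FarkasKra1992, III.7.7 Corollary]
[cite: Miranda1995, Chapter III Proposition 3.1] -/
theorem exists_stabilizer_generators :
    ∃ gen : M → ↥G, ∃ hfix : ∀ P, gen P • P = P,
      ∀ P (u : stabilizer G P), u ∈ Subgroup.zpowers (⟨gen P, mem_stabilizer_iff.2 (hfix P)⟩ : stabilizer G P) := by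
  have hex : ∀ P : M, ∃ t : stabilizer G P, ∀ u : stabilizer G P, u ∈ Subgroup.zpowers t := fun P ↦ by
    haveI := isCyclic_stabilizer hhol_of_holomorphicSMul (H := ↥G) (P := P)
    exact IsCyclic.exists_generator
  choose t ht using hex
  exact ⟨fun P ↦ (t P : ↥G), fun P ↦ mem_stabilizer_iff.1 (t P).2, fun P u ↦ by simpa using ht P u⟩

open Classical in
/-- **THE CHEVALLEY–WEIL FORMULA (intrinsic form).** For `G ≤ Aut M` (`Aut M` finite), `γ` the genus of `M/G`,
and every finite-dimensional complex representation `(V, ρ)` of `G`: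
`Σ_{h ∈ G} tr(h⁻¹|𝓗¹(M))·χ_V(h) = |G|·(dim V^G + dim V·(γ − 1)) + Σ_{P : G_P ≠ 1} Σ_{α=0}^{|G_P|−1} α·N_{P,α}`
with `N_{P,α} = dim {v : ρ(h)v = a_P(h)^α v for all h ∈ G_P}` the multiplicity in `V|_{G_P}` of the `α`-th power of
the rotation character `a_P` of the cyclic group `G_P` («`N^ρ_{C,α}` … independent of the choice of `σ ∈ C`»). The
multiplicity of an irreducible `V` in `𝓗¹(M)` is therefore `d_V(γ − 1) + δ_{V,1} + |G|⁻¹ Σ_P Σ_α α·N_{P,α}`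
(`= d_ρ(g_S − 1) + δ_{ρ,1} + Σ_t Σ_α N_{t,α}·{α/m_t}` after grouping the `|G|/m_t` points over each branch value).
[cite: KopeliovichZemel2019, Theorem 6.6 (q = 1, Γ = 0), Proposition 7.1] [cite: ChevalleyWeil1934Integrale]
[cite: FredianiGhigiPenegini2015, Theorem 2.10 (γ = 0)] -/
theorem chevalleyWeil_sum_trace_inv_mul_trace_eq_iInf [Fintype ↥G] [DecidableEq ↥G] :
    ∑ h : ↥G, LinearMap.trace ℂ ↥(holomorphicOneForms M) (oneFormRep M ((h⁻¹ : ↥G) : autGroup M)) *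
        LinearMap.trace ℂ V (ρ h) =
      Nat.card ↥G * ((finrank ℂ ↥ρ.invariants : ℂ) +
        (finrank ℂ V : ℂ) * ((arithGenus (OrbitSurface G M) : ℂ) - 1)) +
      ∑ P ∈ (ramificationDiv (mk G : M → OrbitSurface G M)).support,
        ∑ α ∈ Finset.range (Nat.card (stabilizer G P)),
          (α : ℂ) * finrank ℂ ↥(⨅ h : ↥(stabilizer G P),
            Module.End.eigenspace (ρ (h : ↥G)) (stabDeriv P (h : ↥G) ^ α)) := by
  obtain ⟨gen, hfix, hgen⟩ := exists_stabilizer_generators G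
  rw [chevalleyWeil_sum_trace_inv_mul_trace_eq G ρ gen (fun P _ ↦ hfix P) (fun P _ u ↦ hgen P u)]
  congr 1
  refine Finset.sum_congr rfl fun P _ ↦ Finset.sum_congr rfl fun α _ ↦ ?_
  rw [eigenspace_eq_iInf_eigenspace_stabDeriv_pow G ρ (hfix P) (hgen P) α]

omit [CompactSpace M] [T2Space M] [PreconnectedSpace M] [Nonempty M] [Finite ↥(autGroup M)] [FiniteDimensional ℂ V] in
/-- **`Σ_h tr(h|𝓗¹)·χ_V(h⁻¹) = Σ_h tr(h⁻¹|𝓗¹)·χ_V(h)`** (reindex by `h ↦ h⁻¹`): the left side is `|G|·⟨χ_{𝓗¹}, χ_V⟩`,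
«the multiplicity of `ρ` inside any representation of `G` on some vector space `V` is `(1/n)Σ_τ χ_V(τ)χ_ρ(τ⁻¹)`».
[cite: KopeliovichZemel2019, Theorem 6.6 (proof)] -/
theorem sum_trace_mul_trace_inv_eq [Fintype ↥G] :
    ∑ h : ↥G, LinearMap.trace ℂ ↥(holomorphicOneForms M) (oneFormRep M (h : autGroup M)) *
        LinearMap.trace ℂ V (ρ h⁻¹) =
      ∑ h : ↥G, LinearMap.trace ℂ ↥(holomorphicOneForms M) (oneFormRep M ((h⁻¹ : ↥G) : autGroup M)) *
        LinearMap.trace ℂ V (ρ h) := by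
  rw [← Equiv.sum_comp (Equiv.inv ↥G)]
  refine Finset.sum_congr rfl fun h _ ↦ ?_
  rw [Equiv.inv_apply, inv_inv]

open Classical in
/-- **THE CHEVALLEY–WEIL FORMULA for a representation without invariants** (`V^G = 0`, e.g. `V` irreducible and
non-trivial): the multiplicity of `V` in `𝓗¹(M)` is
`|G|⁻¹ Σ_h tr(h|𝓗¹) χ_V(h⁻¹) = dim V·(γ − 1) + |G|⁻¹ Σ_{P : G_P ≠ 1} Σ_α α·N_{P,α}`
(«`μ_χ = −d_χ + Σ_i Σ_α E_{i,α}⟨−α/m_i⟩ + ε`» for `γ = 0`; «`d_ρ(g_S − 1) + Σ_C r_C Σ_α N^ρ_{C,α}{−α/o(C)}`» plus `1`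
for the trivial `ρ`, in the source's indexing of the eigenvalues). [cite: KopeliovichZemel2019, Theorem 6.6]
[cite: FredianiGhigiPenegini2015, Theorem 2.10] [cite: ChevalleyWeil1934Integrale] -/
theorem chevalleyWeil_multiplicity_of_invariants_eq_bot [Fintype ↥G] [DecidableEq ↥G] (hV : ρ.invariants = ⊥) :
    (Nat.card ↥G : ℂ)⁻¹ * ∑ h : ↥G, LinearMap.trace ℂ ↥(holomorphicOneForms M) (oneFormRep M (h : autGroup M)) *
        LinearMap.trace ℂ V (ρ h⁻¹) =
      (finrank ℂ V : ℂ) * ((arithGenus (OrbitSurface G M) : ℂ) - 1) +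
      (Nat.card ↥G : ℂ)⁻¹ * ∑ P ∈ (ramificationDiv (mk G : M → OrbitSurface G M)).support,
        ∑ α ∈ Finset.range (Nat.card (stabilizer G P)),
          (α : ℂ) * finrank ℂ ↥(⨅ h : ↥(stabilizer G P),
            Module.End.eigenspace (ρ (h : ↥G)) (stabDeriv P (h : ↥G) ^ α)) := by
  have hG : (Nat.card ↥G : ℂ) ≠ 0 := Nat.cast_ne_zero.2 Nat.card_pos.ne'
  rw [sum_trace_mul_trace_inv_eq, chevalleyWeil_sum_trace_inv_mul_trace_eq_iInf, hV, finrank_bot, Nat.cast_zero,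
    zero_add, mul_add, ← mul_assoc, inv_mul_cancel₀ hG, one_mul]

/-- **The multiplicity of the trivial representation in `𝓗¹(M)` is `γ`: `Σ_{h ∈ G} tr(h|𝓗¹(M)) = γ·|G|`** (the
Chevalley–Weil formula for `V = 1`: all `N_{P,α} = 0` for `α ≥ 1`; «the multiplicity of `1` in that representation is
`g_S`», and `dim 𝓗¹(M)^G = g(M/G)`, V.2.2). [cite: KopeliovichZemel2019, Proposition 7.1] [cite: FarkasKra1992, V.2.2] -/
theorem sum_trace_oneFormRep_eq_arithGenus_mul_card [Fintype ↥G] [DecidableEq ↥G] :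
    ∑ h : ↥G, LinearMap.trace ℂ ↥(holomorphicOneForms M) (oneFormRep M (h : autGroup M)) =
      (arithGenus (OrbitSurface G M) : ℂ) * Nat.card ↥G := by
  obtain ⟨gen, hfix, hgen⟩ := exists_stabilizer_generators G
  have h := chevalleyWeil_sum_trace_inv_mul_trace_eq G (Representation.trivial ℂ ↥G ℂ) gen (fun P _ ↦ hfix P)
    (fun P _ u ↦ hgen P u)
  have htr : ∀ g : ↥G, LinearMap.trace ℂ ℂ ((Representation.trivial ℂ ↥G ℂ) g) = 1 := fun g ↦ by
    rw [show (Representation.trivial ℂ ↥G ℂ) g = 1 from rfl, LinearMap.trace_one, Module.finrank_self, Nat.cast_one]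
  have hinv : finrank ℂ ↥(Representation.trivial ℂ ↥G ℂ).invariants = 1 := by
    rw [Representation.invariants_eq_top, finrank_top, Module.finrank_self]
  -- the local terms vanish: `Eig(1, ε^α) = 0` for `1 ≤ α < m` (`ε` primitive), and `α = 0` contributes `0`
  have hloc : ∀ P ∈ (ramificationDiv (mk G : M → OrbitSurface G M)).support,
      ∑ α ∈ Finset.range (Nat.card (stabilizer G P)), (α : ℂ) *
        finrank ℂ ↥(Module.End.eigenspace ((Representation.trivial ℂ ↥G ℂ) (gen P)) (stabDeriv P (gen P) ^ α)) = 0 := by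
    intro P _
    refine Finset.sum_eq_zero fun α hα ↦ ?_
    rcases Nat.eq_zero_or_pos α with h0 | hpos
    · rw [h0, Nat.cast_zero, zero_mul]
    · have hε := isPrimitiveRoot_stabDeriv_of_forall_mem_zpowers G (hfix P) (hgen P)
      have hne : stabDeriv P (gen P) ^ α ≠ 1 := hε.pow_ne_one_of_pos_of_lt hpos.ne' (Finset.mem_range.1 hα)
      have hbot : Module.End.eigenspace ((Representation.trivial ℂ ↥G ℂ) (gen P)) (stabDeriv P (gen P) ^ α) = ⊥ :=
        eigenspace_eq_bot_of_pow_eq_one (m := 1) (by rw [pow_one]; rfl) (by rwa [pow_one])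
      rw [hbot, finrank_bot, Nat.cast_zero, mul_zero]
  simp_rw [htr, mul_one] at h
  rw [Finset.sum_congr rfl hloc, Finset.sum_const_zero, add_zero, hinv, Module.finrank_self] at h
  rw [← Equiv.sum_comp (Equiv.inv ↥G)]
  simp only [Equiv.inv_apply]
  rw [h]
  push_cast
  ring

end ChevalleyWeil

/-! ### §3 The printed hypothesis: genus `g ≥ 2` -/

section Printed

variable {M : Type*} [TopologicalSpace M] [ChartedSpace ℂ M] [IsManifold 𝓘(ℂ, ℂ) ω M]
  [CompactSpace M] [T2Space M] [PreconnectedSpace M] [Nonempty M]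
  (G : Subgroup (autGroup M)) {V : Type*} [AddCommGroup V] [Module ℂ V] [FiniteDimensional ℂ V]
  (ρ : Representation ℂ ↥G V)

open OrbitSurface

open Classical in
/-- **THE CHEVALLEY–WEIL FORMULA for `M` of genus `g ≥ 2`** (then `Aut M` is finite).
[cite: KopeliovichZemel2019, Theorem 6.6] [cite: ChevalleyWeil1934Integrale] -/
theorem chevalleyWeil_sum_trace_inv_mul_trace_eq_iInf_of_two_le_arithGenus (hg : 2 ≤ arithGenus M)
    [Fintype ↥G] [DecidableEq ↥G] :
    ∑ h : ↥G, LinearMap.trace ℂ ↥(holomorphicOneForms M) (oneFormRep M ((h⁻¹ : ↥G) : autGroup M)) *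
        LinearMap.trace ℂ V (ρ h) =
      Nat.card ↥G * ((finrank ℂ ↥ρ.invariants : ℂ) +
        (finrank ℂ V : ℂ) * ((arithGenus (OrbitSurface G M) : ℂ) - 1)) +
      ∑ P ∈ (ramificationDiv (mk G : M → OrbitSurface G M)).support,
        ∑ α ∈ Finset.range (Nat.card (stabilizer G P)),
          (α : ℂ) * finrank ℂ ↥(⨅ h : ↥(stabilizer G P),
            Module.End.eigenspace (ρ (h : ↥G)) (stabDeriv P (h : ↥G) ^ α)) := by
  haveI : Finite (autGroup M) := finite_autGroup hg
  exact chevalleyWeil_sum_trace_inv_mul_trace_eq_iInf G ρ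

/-- **`Σ_{h ∈ G} tr(h|𝓗¹(M)) = g(M/G)·|G|` for `M` of genus `g ≥ 2`.** [cite: KopeliovichZemel2019, Proposition 7.1]
[cite: FarkasKra1992, V.2.2] -/
theorem sum_trace_oneFormRep_eq_arithGenus_mul_card_of_two_le_arithGenus (hg : 2 ≤ arithGenus M)
    [Fintype ↥G] [DecidableEq ↥G] :
    ∑ h : ↥G, LinearMap.trace ℂ ↥(holomorphicOneForms M) (oneFormRep M (h : autGroup M)) =
      (arithGenus (OrbitSurface G M) : ℂ) * Nat.card ↥G := by
  haveI : Finite (autGroup M) := finite_autGroup hg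
  exact sum_trace_oneFormRep_eq_arithGenus_mul_card G

end Printed

end RiemannSurface

end Literature.Geometry.Kaehler

end
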